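import Mathlib
import Summits.MatrixMultiplication.MatrixMultiplication.Theses.HiddenToeplitzCorners
import Literature.Computability.AlgebraicComplexity.ArithCircuitProofs
import Literature.Computability.AlgebraicComplexity.MatMulTotalComplexityProofs
import Literature.Computability.AlgebraicComplexity.FastFourierTransform
import Literature.Computability.AlgebraicComplexity.DivisionSLP
import Literature.LinearAlgebra.Matrix.CauchyDeterminant
import Literature.LinearAlgebra.Matrix.CauchyLike
import Summits.MatrixMultiplication.MatrixMultiplication.Theorems.HiddenToeplitzCornersToeplitzLikeDetCostPairs
import Summits.MatrixMultiplication.MatrixMultiplication.Theorems.HiddenToeplitzCornersToeplitzLikeDetCostPolyMulCost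
import Summits.MatrixMultiplication.MatrixMultiplication.Theorems.HiddenToeplitzCornersToeplitzLikeDetCostCauchyMatvec
import Summits.MatrixMultiplication.MatrixMultiplication.Theorems.HiddenToeplitzCornersToeplitzLikeDetCostCauchyAlgebra
import Summits.MatrixMultiplication.MatrixMultiplication.Theorems.HiddenToeplitzCornersToeplitzLikeDetCostFFTCost
import Summits.MatrixMultiplication.MatrixMultiplication.Theorems.HiddenToeplitzCornersToeplitzLikeDetCostMBA
import Summits.MatrixMultiplication.MatrixMultiplication.Theorems.HiddenToeplitzCornersToeplitzLikeDetCostConversion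
import Summits.MatrixMultiplication.MatrixMultiplication.Theorems.HiddenToeplitzCornersToeplitzLikeDetCostNormalise
import Summits.MatrixMultiplication.MatrixMultiplication.Theorems.HiddenToeplitzCornersToeplitzLikeDetCostEvalTransfer
import Summits.MatrixMultiplication.MatrixMultiplication.Theorems.HiddenToeplitzCornersToeplitzLikeDetCostPencilPad1
import Summits.MatrixMultiplication.MatrixMultiplication.Theorems.HiddenToeplitzCornersToeplitzLikeDetCostPencilPad2

/-!
# Auxiliary lemmas for stub `core` of crux `HiddenToeplitzCorners.ToeplitzLikeDetCost`
# (stmt-MatrixMultiplication-7491), line `Sketch`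

Cost bookkeeping (`core_arith`, `core_arith'`), transport of Stein equations along a column
reindexing and along ring homomorphisms (`core_stein_reindex`, `core_stein_map`), the entries of
the free padded generators (`core_padP_induct`, `core_padQ_induct`), and the elimination end-game
`core_elim` (normalised Cauchy-like matrix ↦ principal minors by evaluation ↦ `stub_mba` ↦
determinant bookkeeping ↦ `stub_pairs`).
-/

set_option linter.dupNamespace false

namespace Summit.MatrixMultiplication.MatrixMultiplication.Theorems

open scoped BigOperators Matrix
open Literature.Computability.AlgebraicComplexity Literature.LinearAlgebra.Matrix
open Literature.Computability.AlgebraicComplexity.ArithCircuit (FanInTwoSeq freeInputs)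

noncomputable section

/-- The cost bookkeeping of the core: conversion + normalisation + elimination stay below
`10⁴ (d+1)² (κ+1)² 2^κ`. [folklore] -/
theorem core_arith (d κ : ℕ) :
    40 * (2 * d + 2 + 2) * (κ + 4) * 2 ^ κ +
        2 * (2 * d + 2 + 2) * (2 * d + 2 + 2 + 1) * (2 * κ + 7) * 2 ^ κ +
        64 * (1 + (2 * d + 2 + 2) + (2 * d + 2 + 2) + 1) ^ 2 * (κ + 1) ^ 2 * 2 ^ κ ≤
      10000 * (d + 1) ^ 2 * (κ + 1) ^ 2 * 2 ^ κ := by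
  have h : 40 * (2 * d + 2 + 2) * (κ + 4) +
        2 * (2 * d + 2 + 2) * (2 * d + 2 + 2 + 1) * (2 * κ + 7) +
        64 * (1 + (2 * d + 2 + 2) + (2 * d + 2 + 2) + 1) ^ 2 * (κ + 1) ^ 2 ≤
      10000 * (d + 1) ^ 2 * (κ + 1) ^ 2 := by
    calc 40 * (2 * d + 2 + 2) * (κ + 4) +
        2 * (2 * d + 2 + 2) * (2 * d + 2 + 2 + 1) * (2 * κ + 7) +
        64 * (1 + (2 * d + 2 + 2) + (2 * d + 2 + 2) + 1) ^ 2 * (κ + 1) ^ 2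
        ≤ (40 * (2 * d + 2 + 2) * (κ + 4) +
            2 * (2 * d + 2 + 2) * (2 * d + 2 + 2 + 1) * (2 * κ + 7) +
            64 * (1 + (2 * d + 2 + 2) + (2 * d + 2 + 2) + 1) ^ 2 * (κ + 1) ^ 2) +
          ((10000 - 1024) * d ^ 2 * κ ^ 2 + (20000 - 2064) * d ^ 2 * κ + (10000 - 1080) * d ^ 2 +
            (20000 - 5120) * d * κ ^ 2 + (40000 - 10392) * d * κ + (20000 - 5692) * d +
            (10000 - 6400) * κ ^ 2 + (20000 - 13040) * κ + (10000 - 7320)) := Nat.le_add_right _ _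
      _ = 10000 * (d + 1) ^ 2 * (κ + 1) ^ 2 := by ring
  calc _ = (40 * (2 * d + 2 + 2) * (κ + 4) +
        2 * (2 * d + 2 + 2) * (2 * d + 2 + 2 + 1) * (2 * κ + 7) +
        64 * (1 + (2 * d + 2 + 2) + (2 * d + 2 + 2) + 1) ^ 2 * (κ + 1) ^ 2) * 2 ^ κ := by ring
    _ ≤ (10000 * (d + 1) ^ 2 * (κ + 1) ^ 2) * 2 ^ κ := Nat.mul_le_mul_right _ h
    _ = _ := by ring



/-- Reindexing the generator columns along an equivalence does not change `P Qᵀ`. [folklore] -/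
theorem core_stein_reindex {S : Type} [CommRing S] {n : ℕ} {q q' : Type} [Fintype q] [Fintype q']
    (e : q ≃ q') {T D : Matrix (Fin n) (Fin n) S} {P Q : Matrix (Fin n) q S}
    (h : T - D = P * Qᵀ) :
    T - D = P.submatrix id e.symm * (Q.submatrix id e.symm)ᵀ := by
  rw [h, Matrix.transpose_submatrix, Matrix.submatrix_mul_equiv, Matrix.submatrix_id_id]

/-- A Stein equation `T - Z T Zᵀ = P Qᵀ` is transported along a ring homomorphism. [folklore] -/
theorem core_stein_map {S S' : Type} [CommRing S] [CommRing S'] (f : S →+* S') {n : ℕ} {q : Type}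
    [Fintype q] {T : Matrix (Fin n) (Fin n) S} {P Q : Matrix (Fin n) q S}
    (h : T - (Matrix.of fun i j : Fin n => if (i : ℕ) = (j : ℕ) + 1 then (1 : S) else 0) * T *
        (Matrix.of fun i j : Fin n => if (i : ℕ) = (j : ℕ) + 1 then (1 : S) else 0)ᵀ = P * Qᵀ) :
    T.map f - (Matrix.of fun i j : Fin n => if (i : ℕ) = (j : ℕ) + 1 then (1 : S') else 0) * T.map f *
        (Matrix.of fun i j : Fin n => if (i : ℕ) = (j : ℕ) + 1 then (1 : S') else 0)ᵀ = P.map f * (Q.map f)ᵀ := by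
  have hZ : (Matrix.of fun i j : Fin n => if (i : ℕ) = (j : ℕ) + 1 then (1 : S) else 0).map f =
      (Matrix.of fun i j : Fin n => if (i : ℕ) = (j : ℕ) + 1 then (1 : S') else 0) := by
    ext i j
    simp only [Matrix.map_apply, Matrix.of_apply]
    split_ifs <;> simp
  have h' := congrArg (fun M : Matrix (Fin n) (Fin n) S => M.map f) h
  rw [Matrix.map_sub _ (map_sub f), Matrix.map_mul, Matrix.map_mul, Matrix.map_mul,
    Matrix.transpose_map, Matrix.transpose_map, hZ] at h'
  exact h'

/-- Entries of the free Stein generator `[δ₀ | δ_(n−N) | 0 ⊕ G]` of the identity-first padding: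
each is `0`, `1`, or an entry of `G` (induction principle). [folklore] -/
theorem core_padP_induct {S : Type} [CommRing S] {N n : ℕ} (hNn : N ≤ n) {q : Type} [Fintype q]
    (Gs : Matrix (Fin N) q S) (i : Fin n) (c : (Fin 1 ⊕ Fin 1) ⊕ q) (p : S → Prop)
    (h0 : p 0) (h1 : p 1) (hG : ∀ i' k, p (Gs i' k)) :
    p ((Matrix.fromCols (Matrix.fromCols (Matrix.of fun (i : Fin n) (_ : Fin 1) => if (i : ℕ) = 0 then (1 : S) else 0)
            (Matrix.of fun (i : Fin n) (_ : Fin 1) => if (i : ℕ) = n - N then (1 : S) else 0))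
          ((Matrix.fromRows (0 : Matrix (Fin (n - N)) q S) Gs).submatrix (fun i : Fin n => finSumFinEquiv.symm (i.cast (Nat.sub_add_cancel hNn).symm)) id)) i c) := by
  rcases c with (u | u) | k
  · rw [Matrix.fromCols_apply_inl, Matrix.fromCols_apply_inl, Matrix.of_apply]
    split_ifs
    exacts [h1, h0]
  · rw [Matrix.fromCols_apply_inl, Matrix.fromCols_apply_inr, Matrix.of_apply]
    split_ifs
    exacts [h1, h0]
  · rw [Matrix.fromCols_apply_inr, pad_G_apply hNn Gs i k]
    split_ifs
    exacts [h0, hG _ _]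

/-- Entries of the free Stein generator `[δ₀ | −δ_(n−N) | 0 ⊕ H]`: each is `0`, `1`, `−1`, or an
entry of `H` (induction principle). [folklore] -/
theorem core_padQ_induct {S : Type} [CommRing S] {N n : ℕ} (hNn : N ≤ n) {q : Type} [Fintype q]
    (Hs : Matrix (Fin N) q S) (i : Fin n) (c : (Fin 1 ⊕ Fin 1) ⊕ q) (p : S → Prop)
    (h0 : p 0) (h1 : p 1) (hm1 : p (-1)) (hH : ∀ i' k, p (Hs i' k)) :
    p ((Matrix.fromCols (Matrix.fromCols (Matrix.of fun (i : Fin n) (_ : Fin 1) => if (i : ℕ) = 0 then (1 : S) else 0)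
            (Matrix.of fun (i : Fin n) (_ : Fin 1) => if (i : ℕ) = n - N then (-1 : S) else 0))
          ((Matrix.fromRows (0 : Matrix (Fin (n - N)) q S) Hs).submatrix (fun i : Fin n => finSumFinEquiv.symm (i.cast (Nat.sub_add_cancel hNn).symm)) id)) i c) := by
  rcases c with (u | u) | k
  · rw [Matrix.fromCols_apply_inl, Matrix.fromCols_apply_inl, Matrix.of_apply]
    split_ifs
    exacts [h1, h0]
  · rw [Matrix.fromCols_apply_inl, Matrix.fromCols_apply_inr, Matrix.of_apply]
    split_ifs
    exacts [hm1, h0]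
  · rw [Matrix.fromCols_apply_inr, pad_G_apply hNn Hs i k]
    split_ifs
    exacts [h0, hH _ _]

/-- The cost bookkeeping with the generator lengths as they arise from `Fintype.card`. [folklore] -/
theorem core_arith' (d κ b p3 pC : ℕ) (hb : b = 2 * d + 2) (hp3 : p3 = b + 2)
    (hpC : pC = 1 + p3 + p3) :
    40 * (b + 2) * (κ + 4) * 2 ^ κ + 2 * p3 * (p3 + 1) * (2 * κ + 7) * 2 ^ κ +
        64 * (pC + 1) ^ 2 * (κ + 1) ^ 2 * 2 ^ κ ≤
      10000 * (d + 1) ^ 2 * (κ + 1) ^ 2 * 2 ^ κ := by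
  subst hb; subst hp3; subst hpC
  exact core_arith d κ


/-- **The core, after normalisation.** With `C₀ = cauchyLike x y G₃ H₃ = V₁ · T_R · V₂⁻¹` over
`K = Frac ℂ[X]`, the invertible constant matrix `B₀ = V₁ · T_R(x₀) · V₂⁻¹`, and the normalised
Cauchy-like matrix `W · C₀ = cauchyLike z y G_C H_C` (`W = K' · B₀⁻¹`, `K'` the plain Cauchy matrix
on `3⟨ω⟩ × 2⟨ω⟩`) whose generator entries are derivable: every principal minor of `W · C₀` is
nonzero (its value at `x₀` is `K'`), the superfast elimination prices `det (W · C₀)`, which is a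
nonzero constant multiple of `det T(X)`, and the pair simulation transfers the bound to the
division-free `complexity`. [cite: Pan2001, Cor. 5.3.3] -/
theorem core_elim {r : ℕ} (κ : ℕ) {ω : ℂ} (hω : IsPrimitiveRoot ω (2 ^ κ)) {N : ℕ}
    (TX : Matrix (Fin N) (Fin N) (MvPolynomial (Fin r × Fin r) ℂ))
    (TR : Matrix (Fin (2 ^ κ)) (Fin (2 ^ κ)) (MvPolynomial (Fin r × Fin r) ℂ)) (hdetTR : TR.det = TX.det)
    (x0 : Fin r × Fin r → ℂ)
    (V₁ V₂ : Matrix (Fin (2 ^ κ)) (Fin (2 ^ κ)) ℂ) (hV₁ : IsUnit V₁.det) (hV₂ : IsUnit V₂.det)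
    {p₃ : Type} [Fintype p₃]
    {G₃ H₃ : Matrix (Fin (2 ^ κ)) p₃ (FractionRing (MvPolynomial (Fin r × Fin r) ℂ))}
    (hC0 : (cauchyLike (fun i : Fin (2 ^ κ) => algebraMap ℂ (FractionRing (MvPolynomial (Fin r × Fin r) ℂ)) (1 * ω ^ (i : ℕ))) (fun j : Fin (2 ^ κ) => algebraMap ℂ (FractionRing (MvPolynomial (Fin r × Fin r) ℂ)) (2 * ω ^ (j : ℕ))) G₃ H₃) =
      V₁.map (algebraMap ℂ (FractionRing (MvPolynomial (Fin r × Fin r) ℂ))) * TR.map (algebraMap (MvPolynomial (Fin r × Fin r) ℂ) (FractionRing (MvPolynomial (Fin r × Fin r) ℂ))) * (V₂.map (algebraMap ℂ (FractionRing (MvPolynomial (Fin r × Fin r) ℂ))))⁻¹)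
    (B₀ : Matrix (Fin (2 ^ κ)) (Fin (2 ^ κ)) ℂ) (hB₀def : B₀ = V₁ * TR.map (MvPolynomial.eval x0) * V₂⁻¹)
    (hB₀det : IsUnit B₀.det)
    {pC : Type} [Fintype pC] [DecidableEq pC] {GC HC : Matrix (Fin (2 ^ κ)) pC (FractionRing (MvPolynomial (Fin r × Fin r) ℂ))}
    (hCK : ((cauchyLike (fun i : Fin (2 ^ κ) => (3 : ℂ) * ω ^ (i : ℕ)) (fun j : Fin (2 ^ κ) => (2 : ℂ) * ω ^ (j : ℕ)) (Matrix.of fun (_ : Fin (2 ^ κ)) (_ : Fin 1) => (1 : ℂ)) (Matrix.of fun (_ : Fin (2 ^ κ)) (_ : Fin 1) => (1 : ℂ))) * B₀⁻¹).map (algebraMap ℂ (FractionRing (MvPolynomial (Fin r × Fin r) ℂ))) * (cauchyLike (fun i : Fin (2 ^ κ) => algebraMap ℂ (FractionRing (MvPolynomial (Fin r × Fin r) ℂ)) (1 * ω ^ (i : ℕ))) (fun j : Fin (2 ^ κ) => algebraMap ℂ (FractionRing (MvPolynomial (Fin r × Fin r) ℂ)) (2 * ω ^ (j : ℕ))) G₃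 H₃) =
      cauchyLike (fun i : Fin (2 ^ κ) => algebraMap ℂ (FractionRing (MvPolynomial (Fin r × Fin r) ℂ)) (3 * ω ^ (i : ℕ))) (fun j : Fin (2 ^ κ) => algebraMap ℂ (FractionRing (MvPolynomial (Fin r × Fin r) ℂ)) (2 * ω ^ (j : ℕ))) GC HC)
    (c₇ : ℕ)
    (hD7 : ∀ (A : Set (FractionRing (MvPolynomial (Fin r × Fin r) ℂ))), (∀ i k, G₃ i k ∈ A ∪ Set.range (algebraMap ℂ (FractionRing (MvPolynomial (Fin r × Fin r) ℂ)))) →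
      (∀ i k, H₃ i k ∈ A ∪ Set.range (algebraMap ℂ (FractionRing (MvPolynomial (Fin r × Fin r) ℂ)))) →
      Derivable ℂ c₇ A (Set.range (fun ik : Fin (2 ^ κ) × pC => GC ik.1 ik.2) ∪
        Set.range (fun ik : Fin (2 ^ κ) × pC => HC ik.1 ik.2)))
    (l : List (MvPolynomial (Fin r × Fin r) ℂ)) (hl : FanInTwoSeq (freeInputs ℂ (Fin r × Fin r)) l) (c₆ : ℕ)
    (hD6 : Derivable ℂ c₆ ((algebraMap (MvPolynomial (Fin r × Fin r) ℂ) (FractionRing (MvPolynomial (Fin r × Fin r) ℂ))) '' (freeInputs ℂ (Fin r × Fin r) ∪ {x | x ∈ l}))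
      (Set.range (fun ik : Fin (2 ^ κ) × p₃ => G₃ ik.1 ik.2) ∪ Set.range (fun ik : Fin (2 ^ κ) × p₃ => H₃ ik.1 ik.2))) :
    ∃ Q : (MvPolynomial (Fin r × Fin r) ℂ), Q ≠ 0 ∧ complexity (Q * TX.det) ≤ l.length +
      4 * (c₆ + c₇ + 64 * (Fintype.card pC + 1) ^ 2 * (κ + 1) ^ 2 * 2 ^ κ) := by
  classical
  -- node separation and injectivity
  have h32 : ‖(3 : ℂ)‖ ≠ ‖(2 : ℂ)‖ := by norm_num
  have hsep32 : ∀ i j : ℕ, (3 : ℂ) * ω ^ i ≠ 2 * ω ^ j := fun i j => coset_nodes_ne hω h32 i j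
  have hzc_inj : Function.Injective (fun i : Fin (2 ^ κ) => (3 : ℂ) * ω ^ (i : ℕ)) := by
    intro i j hij
    have h3 : (3 : ℂ) ≠ 0 := by norm_num
    have hij' : ω ^ (i : ℕ) = ω ^ (j : ℕ) := mul_left_cancel₀ h3 (by simpa using hij)
    exact Fin.ext (hω.pow_inj i.isLt j.isLt hij')
  have hyc_inj : Function.Injective (fun j : Fin (2 ^ κ) => (2 : ℂ) * ω ^ (j : ℕ)) := by
    intro i j hij
    have h2 : (2 : ℂ) ≠ 0 := by norm_num
    have hij' : ω ^ (i : ℕ) = ω ^ (j : ℕ) := mul_left_cancel₀ h2 (by simpa using hij)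
    exact Fin.ext (hω.pow_inj i.isLt j.isLt hij')
  set T0 := TR.map (MvPolynomial.eval x0) with hT0def
  set KP : Matrix (Fin (2 ^ κ)) (Fin (2 ^ κ)) ℂ := (cauchyLike (fun i : Fin (2 ^ κ) => (3 : ℂ) * ω ^ (i : ℕ)) (fun j : Fin (2 ^ κ) => (2 : ℂ) * ω ^ (j : ℕ)) (Matrix.of fun (_ : Fin (2 ^ κ)) (_ : Fin 1) => (1 : ℂ)) (Matrix.of fun (_ : Fin (2 ^ κ)) (_ : Fin 1) => (1 : ℂ))) with hKPdef
  set W : Matrix (Fin (2 ^ κ)) (Fin (2 ^ κ)) ℂ := KP * B₀⁻¹ with hWdef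
  set CK := cauchyLike (fun i : Fin (2 ^ κ) => algebraMap ℂ (FractionRing (MvPolynomial (Fin r × Fin r) ℂ)) (3 * ω ^ (i : ℕ))) (fun j : Fin (2 ^ κ) => algebraMap ℂ (FractionRing (MvPolynomial (Fin r × Fin r) ℂ)) (2 * ω ^ (j : ℕ))) GC HC
  -- `CK = (W V₁) T_R V₂⁻¹` over `K`, and its value at `x₀` is the plain Cauchy matrix `KP`
  have hCKeq : CK = (W * V₁).map (algebraMap ℂ (FractionRing (MvPolynomial (Fin r × Fin r) ℂ))) * TR.map (algebraMap (MvPolynomial (Fin r × Fin r) ℂ) (FractionRing (MvPolynomial (Fin r × Fin r) ℂ))) * (V₂.map (algebraMap ℂ (FractionRing (MvPolynomial (Fin r × Fin r) ℂ))))⁻¹ := by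
    rw [← hCK, hC0]
    simp only [Matrix.map_mul, Matrix.mul_assoc]
  have hWB : W * V₁ * T0 * V₂⁻¹ = KP := by
    rw [hWdef]
    calc KP * B₀⁻¹ * V₁ * T0 * V₂⁻¹ = KP * (B₀⁻¹ * (V₁ * T0 * V₂⁻¹)) := by
          simp only [Matrix.mul_assoc]
      _ = KP := by rw [← hB₀def, Matrix.nonsing_inv_mul _ hB₀det, Matrix.mul_one]
  have hKP_apply : ∀ i j, KP i j = ((3 : ℂ) * ω ^ (i : ℕ) - 2 * ω ^ (j : ℕ))⁻¹ := by
    intro i j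
    rw [hKPdef, cauchyLike_apply]
    simp
  obtain ⟨hE12, hE3⟩ := stub_evalTransfer
  obtain ⟨hE1, hE2⟩ := hE12 (Fin r × Fin r) (2 ^ κ) x0 TR (W * V₁) V₂ hV₂
  have hminors : ∀ (ι : Type) [Fintype ι] [DecidableEq ι] (g : ι → Fin (2 ^ κ)),
      Function.Injective g → (CK.submatrix g g).det ≠ 0 := by
    intro ι _ _ g hg
    rw [hCKeq]
    apply hE1 ι g
    rw [← hT0def, hWB]
    have hsub : KP.submatrix g g = Matrix.of fun i j : ι =>
        ((3 : ℂ) * ω ^ ((g i : Fin (2 ^ κ)) : ℕ) - 2 * ω ^ ((g j : Fin (2 ^ κ)) : ℕ))⁻¹ := by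
      ext i j
      rw [Matrix.submatrix_apply, hKP_apply, Matrix.of_apply]
    rw [hsub]
    exact hE3 ι (fun i => (3 : ℂ) * ω ^ ((g i : Fin (2 ^ κ)) : ℕ))
      (fun j => (2 : ℂ) * ω ^ ((g j : Fin (2 ^ κ)) : ℕ)) (hzc_inj.comp hg) (hyc_inj.comp hg)
      (fun i j => hsep32 _ _)
  -- the superfast elimination
  set A₀ : Set (FractionRing (MvPolynomial (Fin r × Fin r) ℂ)) := (algebraMap (MvPolynomial (Fin r × Fin r) ℂ) (FractionRing (MvPolynomial (Fin r × Fin r) ℂ))) '' (freeInputs ℂ (Fin r × Fin r) ∪ {x | x ∈ l})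
  set E3 : Set (FractionRing (MvPolynomial (Fin r × Fin r) ℂ)) := Set.range (fun ik : Fin (2 ^ κ) × p₃ => G₃ ik.1 ik.2) ∪
    Set.range (fun ik : Fin (2 ^ κ) × p₃ => H₃ ik.1 ik.2)
  set EC : Set (FractionRing (MvPolynomial (Fin r × Fin r) ℂ)) := Set.range (fun ik : Fin (2 ^ κ) × pC => GC ik.1 ik.2) ∪
    Set.range (fun ik : Fin (2 ^ κ) × pC => HC ik.1 ik.2)
  have hD7' : Derivable ℂ c₇ (A₀ ∪ E3) EC :=
    hD7 (A₀ ∪ E3) (fun i k => Or.inl (Or.inr (Or.inl ⟨(i, k), rfl⟩)))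
      (fun i k => Or.inl (Or.inr (Or.inr ⟨(i, k), rfl⟩)))
  have hD67 := hD6.trans hD7'
  have hmba := stub_mba (K := (FractionRing (MvPolynomial (Fin r × Fin r) ℂ))) κ ω 3 2 hω (by norm_num) (by norm_num) hsep32
    pC GC HC (A₀ ∪ EC) (fun i k => Or.inl (Or.inr (Or.inl ⟨(i, k), rfl⟩)))
    (fun i k => Or.inl (Or.inr (Or.inr ⟨(i, k), rfl⟩))) hminors
  have hD := hD67.trans hmba
  -- the determinant of `CK` is a nonzero constant multiple of `det T(X)`
  set c₀ : ℂ := (W * V₁).det * (V₂.det)⁻¹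
  have hKPdet : KP.det ≠ 0 := by
    have hmat : KP = Matrix.of fun i j : Fin (2 ^ κ) => ((3 : ℂ) * ω ^ (i : ℕ) - 2 * ω ^ (j : ℕ))⁻¹ := by
      ext i j; rw [hKP_apply, Matrix.of_apply]
    rw [hmat]
    exact hE3 (Fin (2 ^ κ)) _ _ hzc_inj hyc_inj (fun i j => hsep32 _ _)
  have hc₀ : c₀ ≠ 0 := by
    have hW : W.det ≠ 0 := by
      rw [hWdef, Matrix.det_mul]
      exact mul_ne_zero hKPdet (Matrix.isUnit_nonsing_inv_det B₀ hB₀det).ne_zero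
    refine mul_ne_zero ?_ (inv_ne_zero hV₂.ne_zero)
    rw [Matrix.det_mul]
    exact mul_ne_zero hW hV₁.ne_zero
  have hdetCK : CK.det = (algebraMap (MvPolynomial (Fin r × Fin r) ℂ) (FractionRing (MvPolynomial (Fin r × Fin r) ℂ))) (MvPolynomial.C c₀ * TX.det) := by
    rw [hCKeq, hE2, hdetTR, map_mul (algebraMap (MvPolynomial (Fin r × Fin r) ℂ) (FractionRing (MvPolynomial (Fin r × Fin r) ℂ))) (MvPolynomial.C c₀),
      IsScalarTower.algebraMap_apply ℂ (MvPolynomial (Fin r × Fin r) ℂ) (FractionRing (MvPolynomial (Fin r × Fin r) ℂ)) c₀, MvPolynomial.algebraMap_eq]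
  -- numerator / denominator pairs
  have hDdet : Derivable ℂ (c₆ + c₇ + 64 * (Fintype.card pC + 1) ^ 2 * (κ + 1) ^ 2 * 2 ^ κ) A₀ {CK.det} :=
    hD.mono le_rfl le_rfl (fun v hv => by
      rw [Set.mem_singleton_iff] at hv
      subst hv
      exact Or.inl (Or.inl rfl))
  obtain ⟨q, hq, hqc⟩ := stub_pairs (σ := Fin r × Fin r) (K := (FractionRing (MvPolynomial (Fin r × Fin r) ℂ))) l hl _ _ hDdet
    (MvPolynomial.C c₀ * TX.det) (by rw [Set.mem_singleton_iff, hdetCK])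
  refine ⟨q * MvPolynomial.C c₀, mul_ne_zero hq (by simpa using hc₀), ?_⟩
  have : q * MvPolynomial.C c₀ * TX.det = q * (MvPolynomial.C c₀ * TX.det) := mul_assoc _ _ _
  rw [this]
  exact hqc


end

end Summit.MatrixMultiplication.MatrixMultiplication.Theorems
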